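import Mathlib
import HarnessLib

/-!
# `FemtoCurvatureSkewness` — negative-side support: a "wild" unit map with singleton level sets

Support file for crux `stmt-QuantumFields-9365` (`LangevinControlUV.FemtoCurvatureSkewness`), line `Sketch-ideator3`,
residual stub `PackagePinsScale` (lead prover-line-stmt-QuantumFields-9365-0, 2026-08-16).

The crux quantifies over ALL unit maps `a : ℝ → ℝ` (no measurability, no monotonicity).  With the axiom of choice
there is, below any prescribed positive function `g`, a positive map `a = exp ∘ (−φ)` whose LEVEL SETS ARE SINGLETONS:
`n · a β = n' · a β'` forces `n = n'` and `β = β'`, and `√m · a β = n'' · a β''` forces `β = β''` and `√m = n''`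
(`exists_wildMap`).  Construction: `Λ := span_ℚ {log n : n ∈ ℕ} ⊂ ℝ` is countable, so the
quotient `ℝ ⧸ Λ` has the cardinality of the continuum and `ℝ` embeds into it; composing with a section gives
`t : ℝ → ℝ` whose pairwise differences avoid `Λ`, and `φ := t + ⌈(−log g − t)/log 2⌉₊ · log 2` keeps that property
(`k · log 2 ∈ Λ`) while forcing `exp (−φ) ≤ g`.  Consumed by `WildPackage.lean`: under uniform comparability of the
torus Wilson covariances such a map carries the two-point package of `FemtoCurvatureTwoPoint`, which makes the residual
stub `PackagePinsScale` ("package maps are comparable") false modulo those uniformities and reduces the typed crux to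
global non-vanishing of `κ₃`.
-/

noncomputable section

namespace Summit.QuantumFields.YangMills.Theorems.FemtoCurvatureSkewness.Negative

open Cardinal Function

/-! Throughout, `Λ := Submodule.span ℚ (Set.range fun n : ℕ => Real.log (n : ℝ))` — the ℚ-span of the logarithms of
the natural numbers — is written out (no definition, no notation: the file stays theorem-only). -/

/-- `log n ∈ Λ`. -/
theorem log_nat_mem_logSpan (n : ℕ) : Real.log (n : ℝ) ∈ (Submodule.span ℚ (Set.range fun n : ℕ => Real.log (n : ℝ))) :=
  Submodule.subset_span ⟨n, rfl⟩

/-- `k · log 2 ∈ Λ` for `k : ℕ`. -/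
theorem nat_mul_log_two_mem_logSpan (k : ℕ) : (k : ℝ) * Real.log 2 ∈ (Submodule.span ℚ (Set.range fun n : ℕ => Real.log (n : ℝ))) := by
  have h2 : Real.log ((2 : ℕ) : ℝ) ∈ (Submodule.span ℚ (Set.range fun n : ℕ => Real.log (n : ℝ))) := log_nat_mem_logSpan 2
  have : ((k : ℚ) : ℝ) • Real.log ((2 : ℕ) : ℝ) ∈ (Submodule.span ℚ (Set.range fun n : ℕ => Real.log (n : ℝ))) := Submodule.smul_mem (Submodule.span ℚ (Set.range fun n : ℕ => Real.log (n : ℝ))) (k : ℚ) h2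
  simpa [Rat.cast_natCast, Nat.cast_ofNat] using this

/-- `(log m)/2 − log n ∈ Λ` (the logarithm of `√m / n`). -/
theorem half_log_sub_log_mem_logSpan (m n : ℕ) : Real.log (m : ℝ) / 2 - Real.log (n : ℝ) ∈ (Submodule.span ℚ (Set.range fun n : ℕ => Real.log (n : ℝ))) := by
  have hm : ((1 / 2 : ℚ) : ℝ) • Real.log (m : ℝ) ∈ (Submodule.span ℚ (Set.range fun n : ℕ => Real.log (n : ℝ))) := Submodule.smul_mem (Submodule.span ℚ (Set.range fun n : ℕ => Real.log (n : ℝ))) _ (log_nat_mem_logSpan m)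
  have hm' : Real.log (m : ℝ) / 2 ∈ (Submodule.span ℚ (Set.range fun n : ℕ => Real.log (n : ℝ))) := by
    have : ((1 / 2 : ℚ) : ℝ) • Real.log (m : ℝ) = Real.log (m : ℝ) / 2 := by
      rw [smul_eq_mul]; push_cast; ring
    rwa [this] at hm
  exact Submodule.sub_mem (Submodule.span ℚ (Set.range fun n : ℕ => Real.log (n : ℝ))) hm' (log_nat_mem_logSpan n)

/-- `Λ` is countable (it is the range of `Finsupp.linearCombination` on the countable type `ℕ →₀ ℚ`). -/
theorem logSpan_countable : ((Submodule.span ℚ (Set.range fun n : ℕ => Real.log (n : ℝ))) : Set ℝ).Countable := by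
  have h : ((Submodule.span ℚ (Set.range fun n : ℕ => Real.log (n : ℝ))) : Set ℝ) =
      Set.range (Finsupp.linearCombination ℚ (fun n : ℕ => Real.log (n : ℝ))) := by
    rw [← Finsupp.range_linearCombination, LinearMap.coe_range]
  rw [h]
  exact Set.countable_range _

/-- Every fibre of the quotient map `ℝ → ℝ ⧸ Λ` is countable (a translate of `Λ`). -/
theorem mk_fibre_countable (c : ℝ ⧸ (Submodule.span ℚ (Set.range fun n : ℕ => Real.log (n : ℝ)))) :
    ((Submodule.Quotient.mk (p := (Submodule.span ℚ (Set.range fun n : ℕ => Real.log (n : ℝ))))) ⁻¹' {c}).Countable := by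
  obtain ⟨x₀, rfl⟩ := Submodule.Quotient.mk_surjective (Submodule.span ℚ (Set.range fun n : ℕ => Real.log (n : ℝ))) c
  have hsub : (Submodule.Quotient.mk (p := (Submodule.span ℚ (Set.range fun n : ℕ => Real.log (n : ℝ))))) ⁻¹' {Submodule.Quotient.mk x₀} ⊆
      (fun l : ℝ => l + x₀) '' ((Submodule.span ℚ (Set.range fun n : ℕ => Real.log (n : ℝ))) : Set ℝ) := by
    intro x hx
    have hx' : (Submodule.Quotient.mk x : ℝ ⧸ (Submodule.span ℚ (Set.range fun n : ℕ => Real.log (n : ℝ)))) = Submodule.Quotient.mk x₀ := hx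
    rw [Submodule.Quotient.eq] at hx'
    exact ⟨x - x₀, hx', by simp⟩
  exact (logSpan_countable.image _).mono hsub

/-- The quotient `ℝ ⧸ Λ` is at least as large as `ℝ`: `#ℝ ≤ #(ℝ ⧸ Λ)` (countable fibres, `ℵ₀ < 𝔠`). -/
theorem mk_real_le_mk_quotient : #ℝ ≤ #(ℝ ⧸ (Submodule.span ℚ (Set.range fun n : ℕ => Real.log (n : ℝ)))) := by
  have hfib : ∀ c : ℝ ⧸ (Submodule.span ℚ (Set.range fun n : ℕ => Real.log (n : ℝ))), #((Submodule.Quotient.mk (p := (Submodule.span ℚ (Set.range fun n : ℕ => Real.log (n : ℝ))))) ⁻¹' {c}) ≤ ℵ₀ :=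
    fun c => (mk_fibre_countable c).le_aleph0
  have h1 : #ℝ ≤ #(ℝ ⧸ (Submodule.span ℚ (Set.range fun n : ℕ => Real.log (n : ℝ)))) * ℵ₀ := mk_le_mk_mul_of_mk_preimage_le _ hfib
  have h2 : #(ℝ ⧸ (Submodule.span ℚ (Set.range fun n : ℕ => Real.log (n : ℝ)))) * ℵ₀ ≤ max (max #(ℝ ⧸ (Submodule.span ℚ (Set.range fun n : ℕ => Real.log (n : ℝ)))) ℵ₀) ℵ₀ := mul_le_max _ _
  have h3 : #ℝ ≤ max #(ℝ ⧸ (Submodule.span ℚ (Set.range fun n : ℕ => Real.log (n : ℝ)))) ℵ₀ := by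
    have := h1.trans h2
    simpa only [max_assoc, max_self] using this
  rcases le_max_iff.1 h3 with h | h
  · exact h
  · exact absurd (mk_real ▸ h) (not_le.2 aleph0_lt_continuum)

/-- A map `t : ℝ → ℝ` whose values at distinct points differ by an element OUTSIDE `Λ`. -/
theorem exists_translation_free_map :
    ∃ t : ℝ → ℝ, ∀ x y : ℝ, t x - t y ∈ (Submodule.span ℚ (Set.range fun n : ℕ => Real.log (n : ℝ))) → x = y := by
  obtain ⟨e⟩ := (Cardinal.le_def ℝ (ℝ ⧸ (Submodule.span ℚ (Set.range fun n : ℕ => Real.log (n : ℝ))))).1 mk_real_le_mk_quotient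
  refine ⟨fun x => surjInv (Submodule.Quotient.mk_surjective (Submodule.span ℚ (Set.range fun n : ℕ => Real.log (n : ℝ)))) (e x), fun x y hxy => ?_⟩
  apply e.injective
  have hx := surjInv_eq (Submodule.Quotient.mk_surjective (Submodule.span ℚ (Set.range fun n : ℕ => Real.log (n : ℝ)))) (e x)
  have hy := surjInv_eq (Submodule.Quotient.mk_surjective (Submodule.span ℚ (Set.range fun n : ℕ => Real.log (n : ℝ)))) (e y)
  rw [← hx, ← hy]
  exact (Submodule.Quotient.eq (Submodule.span ℚ (Set.range fun n : ℕ => Real.log (n : ℝ)))).2 hxy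

/-- **The wild exponent.** For a prescribed lower bound `h : ℝ → ℝ`, a map `φ ≥ h` whose values at distinct points
differ by an element outside `Λ` (shift the translation-free map by multiples of `log 2 ∈ Λ`). -/
theorem exists_wildExponent (h : ℝ → ℝ) :
    ∃ φ : ℝ → ℝ, (∀ x, h x ≤ φ x) ∧ ∀ x y : ℝ, φ x - φ y ∈ (Submodule.span ℚ (Set.range fun n : ℕ => Real.log (n : ℝ))) → x = y := by
  obtain ⟨t, ht⟩ := exists_translation_free_map
  refine ⟨fun x => t x + (⌈(h x - t x) / Real.log 2⌉₊ : ℝ) * Real.log 2, fun x => ?_, fun x y hxy => ?_⟩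
  · have hlog : 0 < Real.log 2 := Real.log_pos (by norm_num)
    have hceil : (h x - t x) / Real.log 2 ≤ (⌈(h x - t x) / Real.log 2⌉₊ : ℝ) := Nat.le_ceil _
    have := mul_le_mul_of_nonneg_right hceil hlog.le
    rw [div_mul_cancel₀ _ hlog.ne'] at this
    linarith
  · apply ht x y
    have hk : ((⌈(h x - t x) / Real.log 2⌉₊ : ℝ) * Real.log 2 -
        (⌈(h y - t y) / Real.log 2⌉₊ : ℝ) * Real.log 2) ∈ (Submodule.span ℚ (Set.range fun n : ℕ => Real.log (n : ℝ))) :=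
      Submodule.sub_mem (Submodule.span ℚ (Set.range fun n : ℕ => Real.log (n : ℝ))) (nat_mul_log_two_mem_logSpan _) (nat_mul_log_two_mem_logSpan _)
    have heq : t x - t y = (t x + (⌈(h x - t x) / Real.log 2⌉₊ : ℝ) * Real.log 2 -
        (t y + (⌈(h y - t y) / Real.log 2⌉₊ : ℝ) * Real.log 2)) -
        ((⌈(h x - t x) / Real.log 2⌉₊ : ℝ) * Real.log 2 - (⌈(h y - t y) / Real.log 2⌉₊ : ℝ) * Real.log 2) := by
      ring
    rw [heq]
    exact Submodule.sub_mem (Submodule.span ℚ (Set.range fun n : ℕ => Real.log (n : ℝ))) hxy hk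

/-- **The wild unit map below `g`.**  For every positive `g : ℝ → ℝ` there is `a : ℝ → ℝ` with `0 < a ≤ g` whose level
sets are singletons: `n · a β = n' · a β'` (`n, n' ≥ 1`) forces `β = β'` and `n = n'`, and `√m · a β = n'' · a β''`
(`m, n'' ≥ 1`) forces `β = β''` and `√m = n''`. -/
theorem exists_wildMap (g : ℝ → ℝ) (hg : ∀ β, 0 < g β) :
    ∃ a : ℝ → ℝ, (∀ β, 0 < a β) ∧ (∀ β, a β ≤ g β) ∧
      (∀ (β β' : ℝ) (n n' : ℕ), 1 ≤ n → 1 ≤ n' → (n : ℝ) * a β = n' * a β' → β = β' ∧ n = n') ∧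
      (∀ (β β'' : ℝ) (m n'' : ℕ), 1 ≤ m → 1 ≤ n'' →
        Real.sqrt m * a β = n'' * a β'' → β = β'' ∧ Real.sqrt m = n'') := by
  obtain ⟨φ, hφ, hinj⟩ := exists_wildExponent fun β => -Real.log (g β)
  refine ⟨fun β => Real.exp (-φ β), fun β => Real.exp_pos _, fun β => ?_, ?_, ?_⟩
  · -- `exp (−φ β) ≤ exp (log (g β)) = g β`
    have h1 : -φ β ≤ Real.log (g β) := by have := hφ β; linarith
    calc Real.exp (-φ β) ≤ Real.exp (Real.log (g β)) := Real.exp_le_exp.2 h1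
      _ = g β := Real.exp_log (hg β)
  · intro β β' n n' hn hn' heq
    have hnpos : (0 : ℝ) < n := by exact_mod_cast hn
    have hn'pos : (0 : ℝ) < n' := by exact_mod_cast hn'
    have hlog := congrArg Real.log heq
    rw [Real.log_mul hnpos.ne' (Real.exp_pos _).ne', Real.log_mul hn'pos.ne' (Real.exp_pos _).ne',
      Real.log_exp, Real.log_exp] at hlog
    have hdiff : φ β - φ β' = Real.log n - Real.log n' := by linarith
    have hmem : φ β - φ β' ∈ (Submodule.span ℚ (Set.range fun n : ℕ => Real.log (n : ℝ))) := by
      rw [hdiff]; exact Submodule.sub_mem (Submodule.span ℚ (Set.range fun n : ℕ => Real.log (n : ℝ))) (log_nat_mem_logSpan n) (log_nat_mem_logSpan n')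
    have hββ' : β = β' := hinj β β' hmem
    subst hββ'
    refine ⟨rfl, ?_⟩
    have : (n : ℝ) = n' := by
      have hne : Real.exp (-φ β) ≠ 0 := (Real.exp_pos _).ne'
      exact mul_right_cancel₀ hne heq
    exact_mod_cast this
  · intro β β'' m n'' hm hn'' heq
    have hmpos : (0 : ℝ) < m := by exact_mod_cast hm
    have hsq : 0 < Real.sqrt m := Real.sqrt_pos.2 hmpos
    have hn''pos : (0 : ℝ) < n'' := by exact_mod_cast hn''
    have hlog := congrArg Real.log heq
    rw [Real.log_mul hsq.ne' (Real.exp_pos _).ne', Real.log_mul hn''pos.ne' (Real.exp_pos _).ne',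
      Real.log_exp, Real.log_exp, Real.log_sqrt hmpos.le] at hlog
    have hdiff : φ β - φ β'' = Real.log m / 2 - Real.log n'' := by linarith
    have hmem : φ β - φ β'' ∈ (Submodule.span ℚ (Set.range fun n : ℕ => Real.log (n : ℝ))) := by
      rw [hdiff]; exact half_log_sub_log_mem_logSpan m n''
    have hββ'' : β = β'' := hinj β β'' hmem
    subst hββ''
    refine ⟨rfl, ?_⟩
    have hne : Real.exp (-φ β) ≠ 0 := (Real.exp_pos _).ne'
    exact mul_right_cancel₀ hne heq

end Summit.QuantumFields.YangMills.Theorems.FemtoCurvatureSkewness.Negative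

end
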